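import Literature.Computability.FineGrained.NSETHNonReducibilityProofs
import Literature.Computability.FineGrained.NSETHMachineModel
import Literature.Computability.FineGrained.SatAlgorithmsTautProofs
import HarnessLib

/-!
# NSETH and the non-reducibility of CNF-SAT to 3SUM: the discharge

This file closes the named fact
`Literature.Computability.FineGrained.not_fgReducible_cnfSATWithSize_threeSUM_of_nseth`
(`SETHHardness.lean`, **fine-grained.S20**): under NSETH there is no deterministic fine-grained
reduction from CNF-SAT (clause budget `c · n`, `c ≥ 2`, time `2ⁿ`) to 3SUM with time `n²`
— Carmosino, Gao, Impagliazzo, Mihajlin, Paturi, Schneider, ITCS 2016, §5 Thm. 2 (NSETH and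
`C ∈ (N ∩ coN)TIME[T_C]` forbid `(SAT, 2ⁿ) ≤_FGR (C, T_C^{1+γ})`) and Thm. 3 (no deterministic
fine-grained reduction from SAT to 3-sum with `T(n) = n^{1.5+γ}`; the vendored statement is the
instance `γ = 1/2`), p. 11 of the proceedings version; the `(N ∩ coN)TIME[Õ(n^{1.5})]` algorithm
for 3-sum is the Lemma of §5.5, p. 19.

It is the assembly theorem `not_fgReducible_cnfSATWithSize_threeSUM_of_nseth_of'`
(`NSETHNonReducibilityProofs.lean`) applied to the two discharged steps of the decomposition
recorded in `NSETHNonReducibility.lean`: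

* the change of machine model `sparseKSATInExpTime_of_cnfSATInThreeSumOracleRAMTime_holds`
  (`NSETHMachineModel.lean`: a word-RAM 3SUM-oracle decider for `CNFSATWithSize c` of exponent
  `ρ < 1` yields multi-stack Turing machines for sparse `k`-SAT of exponent `ρ + η`, the oracle
  being answered by brute force inside the interpreter — possible because in the word-RAM model of
  `FGReducible` every query has `poly(n)` length, see the module docstring of
  `NSETHNonReducibility.lean`), and
* `k`-TAUT from `k`-SAT, `kTAUTInNExpTime_of_kSATInExpTime_holds`
  (`SatAlgorithmsTautProofs.lean`),

step 3 (the quantitative sparsification transfer, Impagliazzo–Paturi–Zane 2001, Cor. 2) being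
already supplied inside `not_fgReducible_cnfSATWithSize_threeSUM_of_nseth_of'` by
`kSATInExpTime_of_sparseKSATInExpTime_quantitative_holds`.

No definition, no statement and no new named fact is introduced here.

## References

* M. L. Carmosino, J. Gao, R. Impagliazzo, I. Mihajlin, R. Paturi, S. Schneider,
  *Nondeterministic extensions of the Strong Exponential Time Hypothesis and consequences for
  non-reducibility*, ITCS 2016, pp. 261–270, doi:10.1145/2840728.2840746 — §3 Def. 1 (fine-grained
  reductions), §5 Thm. 2, Thm. 3, §5.5 Lemma (3-sum in `(N ∩ coN)TIME[Õ(n^{1.5})]`).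
  [key `CarmosinoEtAlITCS2016`]
* R. Impagliazzo, R. Paturi, F. Zane, *Which problems have strongly exponential complexity?*,
  JCSS 63 (2001) 512–530, §2 Cor. 2. [key `ImpagliazzoPaturiZaneJCSS2001`]
* S. A. Cook, R. A. Reckhow, *Time bounded random access machines*, JCSS 7 (1973) 354–375, §2.
  [key `CookReckhow1973`]
-/

namespace Literature.Computability.FineGrained

/-- **NSETH ⇒ CNF-SAT has no deterministic fine-grained `(2ⁿ, n²)` reduction to 3SUM**
(discharge of the named fact `not_fgReducible_cnfSATWithSize_threeSUM_of_nseth`): the assembly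
`not_fgReducible_cnfSATWithSize_threeSUM_of_nseth_of'` fed with the proved change of machine model
`sparseKSATInExpTime_of_cnfSATInThreeSumOracleRAMTime_holds` and the proved
`kTAUTInNExpTime_of_kSATInExpTime_holds`.
[cite: CarmosinoEtAlITCS2016, §5 Thm. 3 (with Thm. 2 and the Lemma of §5.5)] -/
theorem not_fgReducible_cnfSATWithSize_threeSUM_of_nseth_holds :
    not_fgReducible_cnfSATWithSize_threeSUM_of_nseth :=
  not_fgReducible_cnfSATWithSize_threeSUM_of_nseth_of'
    sparseKSATInExpTime_of_cnfSATInThreeSumOracleRAMTime_holds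
    kTAUTInNExpTime_of_kSATInExpTime_holds

end Literature.Computability.FineGrained
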